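import Summits.AnomalousDissipation.AnomalousDissipation.Theses.WazewskiBlock
import Literature.Analysis.FluidPDE.GalerkinFlow
import Literature.Dynamics.ConleyIndex.Semiflow

/-!
# Sketch — crux-ideate stmt-AnomalousDissipation-10353 (`WazewskiBlock.UniformWorkFloorTrap`), round 1, ideator 2

Typed companions of this seat's crux idea cards (planner-cruxidea-stmt-AnomalousDissipation-10353-2-0):
* §0 the crux unbundled: `TrapClauses`, `TrapAt`, `trap_iff` (definitional);
  `trapAt_of_forwardOrbit` (PROVED): a forward `galerkinFlow` orbit staying in the block
  `B = {KE ≤ E} ∩ {W ≥ ε₀}` IS a witness of the crux at `(ν, N)` — the crux is `Inv⁺(B) ≠ ∅`.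
* §1 card `closing-lemma-rare-dips`: FIRST LEMMA `finiteHorizon_principle` (PROVED, pure topology:
  arbitrarily long sojourns in a compact block ⇒ an infinite one) and its contrapositive
  `uniform_flushing` (PROVED): ¬trap ⇒ a UNIFORM exit time; `PeriodicTransfer` +
  `periodicTransfer_holds` (PROVED): a loud bounded periodic Galerkin orbit is a witness.
* §2 card `index-descent-kills-N`: `WorkLipschitz` (typed, provable now), `IsGalerkinSteady`,
  `SteadyTransfer` (typed), `NondegenerateSteady`, `GalerkinSteadyPersistence` (BRR, typed),
  `RobustSteadyDescent` (typed toy instance of the descent C⁺ → crux).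
* §3 card `ekman-handoff`: `StressCeiling`/`NoTrapBelowStressThreshold` (necessary condition, typed),
  `laminar_exit_iff` (PROVED real algebra: the damped laminar state leaves the energy cap exactly at
  `σ + νλ_f = ‖f‖ / (2E)^{1/2}`).
-/

noncomputable section

set_option linter.dupNamespace false
set_option linter.unusedVariables false

open MeasureTheory Filter Topology Set
open scoped ENNReal BigOperators

namespace Summit.AnomalousDissipation.AnomalousDissipation.Cruxes.UniformWorkFloorTrap.Ideator2

open Literature.Analysis.FunctionSpaces Literature.Analysis.FluidPDE
open Literature.Dynamics.ConleyIndex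
open Summit.AnomalousDissipation.AnomalousDissipation.Theses.WazewskiBlock

/-- Local notation: the flat 3-torus. -/
local notation "𝕋³" => UnitAddTorus (Fin 3)
/-- Local notation: velocity values. -/
local notation "E³" => EuclideanSpace ℝ (Fin 3)

/-! ## §0 The crux per `(ν, N, f, E, ε₀)` -/

/-- The four trajectory clauses (joint continuity, Galerkin-`N` + weakly div-free slices, tested
Galerkin equations, exact energy identity) and the block clause (5) of the crux, for one curve `U`.
Written with `IsGalerkinMode` (definitionally the inlined conjunction of the route file). -/
def TrapClauses (ν : ℝ) (N : ℕ) (f : 𝕋³ → E³) (E ε₀ : ℝ) (U : ℝ → 𝕋³ → E³) : Prop :=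
  (ContinuousOn (Torus.stLift U) (Set.Ici 0 ×ˢ Set.univ) ∧
    (∀ t : ℝ, 0 ≤ t → IsGalerkinMode N (U t) ∧ Torus.IsWeaklyDivFree (U t)) ∧
    (∀ a : 𝕋³ → E³, IsGalerkinMode N a → ∀ s t : ℝ, 0 ≤ s → s ≤ t →
      (∫ x, inner ℝ (U t x) (a x)) - ∫ x, inner ℝ (U s x) (a x) =
        ∫ τ in s..t, ∫ x, (inner ℝ (U τ x) (Torus.convect (U τ) a x) +
          ν * inner ℝ (U τ x) (Torus.laplacian a x) + inner ℝ (f x) (a x))) ∧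
    (∀ s t : ℝ, 0 ≤ s → s ≤ t →
      Torus.kineticEnergy (U t) + ν * (∫⁻ τ in Set.Ioo s t, Torus.eGradNormSq (U τ)).toReal =
        Torus.kineticEnergy (U s) + ∫ τ in s..t, ∫ x, inner ℝ (f x) (U τ x))) ∧
  (∀ t : ℝ, 0 ≤ t → Torus.kineticEnergy (U t) ≤ E ∧ ε₀ ≤ ∫ x, inner ℝ (f x) (U t x))

/-- The crux at one `(ν, N)` for a given force and block constants. -/
def TrapAt (ν : ℝ) (N : ℕ) (f : 𝕋³ → E³) (E ε₀ : ℝ) : Prop :=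
  ∃ U : ℝ → 𝕋³ → E³, TrapClauses ν N f E ε₀ U

/-- The crux is the `∃ f ∀ ν ∃ N₀ ∀ N ≥ N₀` closure of `TrapAt` (definitional unfolding). -/
theorem trap_iff :
    UniformWorkFloorTrap ↔ ∃ (m : ℕ) (f : 𝕋³ → E³), IsGalerkinMode m f ∧ Torus.HasZeroMean f ∧
      ∃ (E ε₀ ν₀ : ℝ), 0 < ε₀ ∧ 0 < ν₀ ∧ ∀ ν : ℝ, 0 < ν → ν ≤ ν₀ →
        ∃ N₀ : ℕ, ∀ N : ℕ, N₀ ≤ N → TrapAt ν N f E ε₀ :=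
  Iff.rfl

/-- **A trapped forward orbit of the Galerkin semiflow witnesses the crux at `(ν, N)`** (PROVED):
clauses (1)–(4) hold for every orbit `t ↦ galerkinFlow ν f N t a` of a Galerkin mode `a`
(`IsGalerkinMode.galerkinFlow_clauses`), so only the block clause (5) is asked of the orbit. -/
theorem trapAt_of_forwardOrbit {ν : ℝ} {N : ℕ} {f a : 𝕋³ → E³} {E ε₀ : ℝ}
    (ha : IsGalerkinMode N a) (hν : 0 ≤ ν) (hf : MemLp f 2 volume)
    (hB : ∀ t : ℝ, 0 ≤ t → Torus.kineticEnergy (Torus.galerkinFlow ν f N t a) ≤ E ∧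
      ε₀ ≤ ∫ x, inner ℝ (f x) (Torus.galerkinFlow ν f N t a x)) :
    TrapAt ν N f E ε₀ := by
  obtain ⟨-, h1, h2, h3, h4⟩ := ha.galerkinFlow_clauses hν hf (ν := ν)
  exact ⟨fun t => Torus.galerkinFlow ν f N t a, ⟨h1, h2, h3, h4⟩, hB⟩

/-! ## §1 Card `closing-lemma-rare-dips`: sojourns, flushing, periodic transfer -/

/-- **FIRST LEMMA (finite-horizon principle), PROVED.** For a continuous semiflow `φ` and a
COMPACT closed block `B`: if for every horizon `n` some point of `B` stays in `B` on `[0, n]`, then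
some point stays in `B` for all `t ≥ 0` (Cantor intersection of the nested closed survivor sets).
Hence the crux at `(ν, N)` ⟺ arbitrarily long loud bounded sojourns ⟺ `sup` exit time `= ∞`. -/
theorem finiteHorizon_principle {X : Type*} [TopologicalSpace X] {φ : ℝ → X → X}
    (hφ : IsSemiflow φ) {B : Set X} (hBc : IsCompact B) (hBcl : IsClosed B)
    (h : ∀ n : ℕ, ∃ x ∈ B, ∀ t ∈ Set.Icc (0 : ℝ) n, φ t x ∈ B) :
    ∃ x ∈ B, ∀ t : ℝ, 0 ≤ t → φ t x ∈ B := by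
  classical
  let K : ℕ → Set X := fun n => B ∩ ⋂ t ∈ Set.Icc (0 : ℝ) n, (φ t) ⁻¹' B
  have hKsub : ∀ n, K n ⊆ B := fun n => Set.inter_subset_left
  have hKcl : ∀ n, IsClosed (K n) := by
    intro n
    refine hBcl.inter (isClosed_biInter fun t ht => ?_)
    exact hBcl.preimage (hφ.continuous_apply ht.1)
  have hKcpt : ∀ n, IsCompact (K n) := fun n => hBc.of_isClosed_subset (hKcl n) (hKsub n)
  have hKne : ∀ n, (K n).Nonempty := by
    intro n
    obtain ⟨x, hxB, hx⟩ := h n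
    exact ⟨x, hxB, Set.mem_iInter₂.mpr fun t ht => hx t ht⟩
  have hmono : ∀ m n, m ≤ n → K n ⊆ K m := by
    intro m n hmn x hx
    refine ⟨hx.1, Set.mem_iInter₂.mpr fun t ht => ?_⟩
    have ht' : t ∈ Set.Icc (0 : ℝ) n := ⟨ht.1, ht.2.trans (by exact_mod_cast hmn)⟩
    exact (Set.mem_iInter₂.mp hx.2) t ht'
  have hdir : Directed (· ⊇ ·) K := by
    intro m n
    exact ⟨max m n, hmono m _ (le_max_left m n), hmono n _ (le_max_right m n)⟩
  obtain ⟨x, hx⟩ := IsCompact.nonempty_iInter_of_directed_nonempty_isCompact_isClosed K hdir hKne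
    hKcpt hKcl
  have hxK : ∀ n, x ∈ K n := fun n => Set.mem_iInter.mp hx n
  refine ⟨x, (hxK 0).1, fun t ht => ?_⟩
  obtain ⟨n, hn⟩ := exists_nat_ge t
  exact (Set.mem_iInter₂.mp (hxK n).2) t ⟨ht, hn⟩

/-- **Uniform flushing (contrapositive, PROVED).** If NO forward orbit stays in the compact block,
there is a UNIFORM horizon `n` by which every point of `B` has left `B` at least once. This is the
form the negative side must prove ("every large-order Galerkin orbit leaves `{KE ≤ E, W ≥ ε₀}` within
a bounded time"), and the form a sojourn-time experiment can contradict. -/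
theorem uniform_flushing {X : Type*} [TopologicalSpace X] {φ : ℝ → X → X}
    (hφ : IsSemiflow φ) {B : Set X} (hBc : IsCompact B) (hBcl : IsClosed B)
    (h : ¬ ∃ x ∈ B, ∀ t : ℝ, 0 ≤ t → φ t x ∈ B) :
    ∃ n : ℕ, ∀ x ∈ B, ∃ t ∈ Set.Icc (0 : ℝ) n, φ t x ∉ B := by
  by_contra hcon
  push Not at hcon
  exact h (finiteHorizon_principle hφ hBc hBcl fun n => by
    obtain ⟨x, hxB, hx⟩ := hcon n
    exact ⟨x, hxB, hx⟩)

/-- **Periodic transfer.** A loud bounded PERIODIC orbit of the Galerkin semiflow — the object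
Katok's closing lemma produces — is a witness: bounds on one period give bounds for all `t ≥ 0`. -/
def PeriodicTransfer : Prop :=
  ∀ (ν : ℝ) (N : ℕ) (f a : 𝕋³ → E³) (E ε₀ T : ℝ), 0 ≤ ν → MemLp f 2 volume → IsGalerkinMode N a →
    0 < T → Torus.galerkinFlow ν f N T a = a →
    (∀ t ∈ Set.Icc (0 : ℝ) T, Torus.kineticEnergy (Torus.galerkinFlow ν f N t a) ≤ E ∧
      ε₀ ≤ ∫ x, inner ℝ (f x) (Torus.galerkinFlow ν f N t a x)) →
    TrapAt ν N f E ε₀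

/-- Whole periods return to the start. [folklore] -/
theorem galerkinFlow_nat_mul_period {ν : ℝ} {N : ℕ} {f a : 𝕋³ → E³} {T : ℝ}
    (ha : IsGalerkinMode N a) (hν : 0 ≤ ν) (hf : Integrable f volume) (hT : 0 ≤ T)
    (hper : Torus.galerkinFlow ν f N T a = a) (k : ℕ) :
    Torus.galerkinFlow ν f N (k * T) a = a := by
  induction k with
  | zero => simp [Torus.galerkinFlow_zero]
  | succ k ih =>
    have hk : (0 : ℝ) ≤ k * T := mul_nonneg (Nat.cast_nonneg k) hT
    have : ((k + 1 : ℕ) : ℝ) * T = k * T + T := by push_cast; ring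
    rw [this, ha.galerkinFlow_add hν hf hk hT, hper, ih]

/-- **`PeriodicTransfer` holds (PROVED):** reduce `t ≥ 0` modulo the period with `Nat.floor`, use
the semigroup law `galerkinFlow_add` and `trapAt_of_forwardOrbit`. -/
theorem periodicTransfer_holds : PeriodicTransfer := by
  intro ν N f a E ε₀ T hν hf ha hT hper hB
  refine trapAt_of_forwardOrbit ha hν hf fun t ht => ?_
  have hfi : Integrable f volume := hf.integrable one_le_two
  set k : ℕ := ⌊t / T⌋₊ with hk
  have hk1 : (k : ℝ) ≤ t / T := Nat.floor_le (div_nonneg ht hT.le)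
  have hk2 : t / T < k + 1 := Nat.lt_floor_add_one (t / T)
  have hkT : (k : ℝ) * T ≤ t := by
    have := mul_le_mul_of_nonneg_right hk1 hT.le
    rwa [div_mul_cancel₀ t hT.ne'] at this
  have htT : t < (k + 1) * T := by
    have := mul_lt_mul_of_pos_right hk2 hT
    rwa [div_mul_cancel₀ t hT.ne'] at this
  set s : ℝ := t - k * T with hs
  have hs0 : 0 ≤ s := by rw [hs]; linarith
  have hsT : s ≤ T := by rw [hs]; nlinarith
  have hkT0 : (0 : ℝ) ≤ k * T := mul_nonneg (Nat.cast_nonneg k) hT.le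
  have hts : t = s + k * T := by rw [hs]; ring
  have hflow : Torus.galerkinFlow ν f N t a = Torus.galerkinFlow ν f N s a := by
    rw [hts, ha.galerkinFlow_add hν hfi hs0 hkT0, galerkinFlow_nat_mul_period ha hν hfi hT.le hper k]
  rw [hflow]
  exact hB s ⟨hs0, hsT⟩

/-! ## §2 Card `index-descent-kills-N`: Lipschitz work, steady and robust-steady transfers -/

/-- The instantaneous Reynolds stress of `U` against the forcing profile, `b(U,U,f) = ∫⟪U,(U·∇)f⟫`
(so that along a Galerkin orbit `Ẇ = ‖f‖² + ν∫⟪U,Δf⟫ + b(U,U,f)` by the tested identity with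
`a := f`; sign convention of `Torus.convect`). -/
def stress (f U : 𝕋³ → E³) : ℝ := ∫ x, inner ℝ (U x) (Torus.convect U f x)

/-- **Work is Lipschitz along capped orbits (typed; provable now from clause (3) with `a := f`).**
For a Galerkin-mode force of order `m ≤ N` and a curve satisfying the trajectory clauses with
`KE ≤ E` on `[s, t]`, `|W(t) − W(s)| ≤ M (t − s)` with the `ν`-, `N`-UNIFORM constant
`M = ‖f‖₂² + ν‖Δf‖₂(2E)^{1/2} + L_f · 2E`, `L_f` = sup-norm of the symmetric gradient of `f`
(here any `L` with `|stress f U| ≤ L · 2 KE(U)`). Consequence: a pointwise floor `W ≥ ε₀` is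
EQUIVALENT to a floor `≥ 2ε₀` on time-windows of length `ε₀ / M` — dips are slow, rate-function
objects. -/
def WorkLipschitz : Prop :=
  ∀ (ν : ℝ) (m N : ℕ) (f : 𝕋³ → E³) (E ε₀ L : ℝ) (U : ℝ → 𝕋³ → E³), 0 ≤ ν → m ≤ N →
    IsGalerkinMode m f → (∀ V : 𝕋³ → E³, IsGalerkinMode N V → |stress f V| ≤ L * (2 * Torus.kineticEnergy V)) →
    TrapClauses ν N f E ε₀ U →
    ∀ s t : ℝ, 0 ≤ s → s ≤ t →
      |(∫ x, inner ℝ (f x) (U t x)) - ∫ x, inner ℝ (f x) (U s x)| ≤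
        ((∫ x, ‖f x‖ ^ 2) + ν * (∫ x, ‖Torus.laplacian f x‖ ^ 2) ^ (1 / 2 : ℝ) * (2 * E) ^ (1 / 2 : ℝ)
          + L * (2 * E)) * (t - s)

/-- `U` is a STEADY state of the order-`N` Galerkin system at `(ν, f)`: a Galerkin mode annihilating
the tested Galerkin equations (the form of `exists_steady_galerkin_approx`). -/
def IsGalerkinSteady (ν : ℝ) (N : ℕ) (f U : 𝕋³ → E³) : Prop :=
  IsGalerkinMode N U ∧ Torus.HasZeroMean U ∧
    ∀ a : 𝕋³ → E³, IsGalerkinMode N a →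
      ∫ x, (inner ℝ (U x) (Torus.convect U a x) + ν * inner ℝ (U x) (Torus.laplacian a x) +
        inner ℝ (f x) (a x)) = 0

/-- **Steady transfer (typed; provable now, S-sized):** a loud bounded Galerkin steady state is a
(constant) trapped trajectory — clauses (3),(4) collapse to the tested steady equation and the steady
energy balance `ν‖∇U‖² = (f, U)` (test with `a := U`, `∫⟪U,(U·∇)U⟫ = 0`). This is the edge
`GalerkinSteadyZerothLaw`-uniform ⇒ `UniformWorkFloorTrap` (MirrorVariety's rank-0 crux has `∃ᶠ N`
and a sequence `ν_j`; the crux needs `∀ N ≥ N₀`, `∀ ν ≤ ν₀`). -/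
def SteadyTransfer : Prop :=
  ∀ (ν : ℝ) (N : ℕ) (f U : 𝕋³ → E³) (E ε₀ : ℝ), 0 < ν → IsGalerkinSteady ν N f U →
    Torus.kineticEnergy U ≤ E → ε₀ ≤ (∫ x, inner ℝ (f x) (U x)) → TrapAt ν N f E ε₀

/-- A smooth steady Navier–Stokes state `u` of `NS_ν(f)` (tested weak form, as in
`TaylorCertificates.SteadyStatesLoudBounded`) whose LINEARISATION is injective on smooth div-free
mean-zero fields: `ν Δw − (u·∇)w − (w·∇)u ⊥` all tests `⇒ w = 0`. Injective ⇒ (Fredholm, compact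
perturbation of `νA`) the branch is nonsingular in the sense of Brezzi–Rappaz–Raviart. -/
def NondegenerateSteady (ν : ℝ) (f u : 𝕋³ → E³) : Prop :=
  Torus.IsSmooth u ∧ Torus.IsDivFree u ∧ Torus.HasZeroMean u ∧
  (∀ w : 𝕋³ → E³, Torus.IsSmooth w → Torus.IsDivFree w → Torus.HasZeroMean w →
    ∫ x, inner ℝ (ν • Torus.laplacian u x - Torus.convect u u x + f x) (w x) = 0) ∧
  (∀ w : 𝕋³ → E³, Torus.IsSmooth w → Torus.IsDivFree w → Torus.HasZeroMean w →
    (∀ a : 𝕋³ → E³, Torus.IsSmooth a → Torus.IsDivFree a → Torus.HasZeroMean a →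
      ∫ x, inner ℝ (ν • Torus.laplacian w x - Torus.convect u w x - Torus.convect w u x) (a x) = 0) →
    ∀ x, w x = 0)

/-- **Galerkin persistence of nonsingular steady states (typed; Literature-fact candidate:
Brezzi–Rappaz–Raviart 1980 Thm 3 / Girault–Raviart 1986 Ch. IV Thm 3.3; L-sized in Lean).**
The simplest instance of the descent `nonzero index at the PDE level ⇒ invariant sets of ALL large
Galerkin orders nearby`: a nondegenerate steady state of `NS_ν(f)` (trig-poly `f`) is the `L²`-limit
of Galerkin steady states of EVERY large order. -/
def GalerkinSteadyPersistence : Prop :=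
  ∀ (ν : ℝ) (m : ℕ) (f u : 𝕋³ → E³), 0 < ν → IsGalerkinMode m f → NondegenerateSteady ν f u →
    ∀ δ : ℝ, 0 < δ → ∃ N₀ : ℕ, ∀ N : ℕ, N₀ ≤ N → ∃ U : 𝕋³ → E³,
      IsGalerkinSteady ν N f U ∧ ∫ x, ‖U x - u x‖ ^ 2 ≤ δ

/-- **Robust-steady descent (typed; follows from `GalerkinSteadyPersistence` + `SteadyTransfer` by
strict inequalities and `L²`-continuity of `KE`, `W` on Galerkin modes):** nondegenerate steady
states of `NS_ν(f)` STRICTLY inside the block for all small `ν` give the crux — `N` has disappeared.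
The card's C⁺ replaces "nondegenerate steady" by "isolated invariant set with nonzero
Conley–Rybakowski index" (hyperbolic periodic orbits, attractors), which is where turbulence lives;
this decl is the typed toy of that descent. -/
def RobustSteadyDescent : Prop :=
  (∃ (m : ℕ) (f : 𝕋³ → E³), IsGalerkinMode m f ∧ Torus.HasZeroMean f ∧
    ∃ (E ε₀ ν₀ : ℝ), 0 < ε₀ ∧ 0 < ν₀ ∧ ∀ ν : ℝ, 0 < ν → ν ≤ ν₀ →
      ∃ u : 𝕋³ → E³, NondegenerateSteady ν f u ∧ Torus.kineticEnergy u < E ∧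
        ε₀ < ∫ x, inner ℝ (f x) (u x)) →
  GalerkinSteadyPersistence → SteadyTransfer → UniformWorkFloorTrap

/-! ## §3 Card `ekman-handoff`: the stress ceiling and the laminar exit -/

/-- **Necessary condition (typed; provable now from clause (3) with `a := f`):** if on the energy
ball the Reynolds stress can NEVER cancel the injection — `sup_{KE ≤ E} (−stress f U) < ‖f‖² −
ν‖Δf‖(2E)^{1/2}` — then `W` increases at a uniform rate along any curve in the block and the block is
left by time `‖f‖(2E)^{1/2}/δ`: NO trap. For Kolmogorov forcing `F sin(2πmy)e_x` this reads
`E ≥ F/(4πm)·(1 − O(ν))` — the block must reach K41 energies `E ≳ F/m`. -/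
def NoTrapBelowStressThreshold : Prop :=
  ∀ (ν : ℝ) (m N : ℕ) (f : 𝕋³ → E³) (E ε₀ δ : ℝ), 0 ≤ ν → m ≤ N → IsGalerkinMode m f → 0 < δ →
    (∀ V : 𝕋³ → E³, IsGalerkinMode N V → Torus.kineticEnergy V ≤ E →
      δ ≤ (∫ x, ‖f x‖ ^ 2) + ν * (∫ x, inner ℝ (V x) (Torus.laplacian f x)) + stress f V) →
    ¬ TrapAt ν N f E ε₀

/-- **The damped laminar state leaves the energy cap exactly at `σ + νλ_f = ‖f‖/(2E)^{1/2}`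
(PROVED, real algebra).** For a single-shell force (`−Δf = λ_f f`, `B(f,f) = ∇p`, e.g. Kolmogorov)
the Ekman-damped laminar state is `L_σ = f/(νλ_f + σ)` with `KE(L_σ) = ‖f‖²/(2(νλ_f+σ)²)`; along
the friction homotopy `σ ↓ 0` it exits `{KE ≤ E}` through the ENERGY face, never the work face
(`W(L_σ) = ‖f‖²/(νλ_f+σ)` grows as `σ ↓`). Variables: `a = νλ_f + σ > 0`, `q = ‖f‖² ≥ 0`. -/
theorem laminar_exit_iff (a q E : ℝ) (ha : 0 < a) (hq : 0 ≤ q) (hE : 0 < E) :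
    q / (2 * a ^ 2) ≤ E ↔ Real.sqrt q / Real.sqrt (2 * E) ≤ a := by
  have h2E : 0 < 2 * E := by positivity
  have hs2E : 0 < Real.sqrt (2 * E) := Real.sqrt_pos.mpr h2E
  rw [div_le_iff₀ (by positivity), div_le_iff₀ hs2E]
  constructor
  · intro h
    -- q ≤ E * (2 a²) = (a √(2E))²
    have h' : q ≤ (a * Real.sqrt (2 * E)) ^ 2 := by
      rw [mul_pow, Real.sq_sqrt h2E.le]; nlinarith
    calc Real.sqrt q ≤ Real.sqrt ((a * Real.sqrt (2 * E)) ^ 2) := Real.sqrt_le_sqrt h'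
      _ = a * Real.sqrt (2 * E) := Real.sqrt_sq (by positivity)
  · intro h
    have h' : Real.sqrt q ^ 2 ≤ (a * Real.sqrt (2 * E)) ^ 2 :=
      pow_le_pow_left₀ (Real.sqrt_nonneg q) h 2
    rw [Real.sq_sqrt hq, mul_pow, Real.sq_sqrt h2E.le] at h'
    nlinarith

end Summit.AnomalousDissipation.AnomalousDissipation.Cruxes.UniformWorkFloorTrap.Ideator2
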